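import Summits.SmoothPoincare4.SmoothPoincare4.Theses.VerlindeRLinks
import Literature.Topology.FourManifolds.FreeFundamentalGroupThreeManifoldHempel
import Literature.Topology.FourManifolds.DehnSurgeryProofs
import Literature.Topology.FourManifolds.DehnSurgeryCompactProofs
import Literature.Topology.FourManifolds.KirbyMovesProofs
import Literature.Topology.FourManifolds.KirbyCalculusUnlinkProofs
import Literature.Topology.FourManifolds.LinkSurgeryFramedUniqueness
import Literature.Topology.FourManifolds.KnotGroupTorusKnotProofs
import Literature.Topology.FourManifolds.SliceKnots
import Mathlib.Data.Int.Order.Units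

/-!
# Disproof of `VrlComponentsHBallSlice` (stmt-SmoothPoincare4-15874) — findings

**Verdict after cycle 2 (cdisprove, 2026-08-17): NO KILL; the crux is a theorem on paper and 3 of the
5 registered stubs of the picked line have LANDED.**  Cycle-2 additions (search `§1b`, `§4`, `§6`):
* §1b the missing input `H` of the load-bearing analysis ("some knot is not slice in any homotopy
  ball") is now DISCHARGED MODULO NAMED FACTS: the trefoil `torusKnot 2 3` (an honest `Knot`,
  `instTorusKnotFacts` proved) is not H-ball-slice given `isAlexanderPolynomial_torusKnot`
  (Rolfsen §7.D), `exists_eq_mul_invert_of_isTopologicallySlice` (Fox–Milnor, proved in the tree from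
  its geometric half) and Freedman's "H-ball-slice ⇒ topologically slice" (explicit binder); the
  algebra `t² - t + 1 ≠ u·f(t)·f(t⁻¹)` (evaluate at `t = -1`: `3 ≠ ±m²`) is kernel-checked; landed
  companion: `Theorems/VrlComponentsHBallSlice/Negative/LoadBearingTrefoil.lean` (cycle 2) on top of
  `Negative/LoadBearing.lean` (cycle 1, p160725).
* §4 targets: `stub_exists_disjoint_framedTubes` (p159271), `stub_attachingMap_of_tube` (p160952),
  `stub_isSurgery_boundary_of_isMultiAttachment` (p160139) LANDED; the two active stubs
  (`stub_oneHandlebody_boundary`, `stub_core_isSliceDiscIn_of_isMultiAttachment`) re-read against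
  `HasHandleDecomposition` (Morse-count, `ncard` safe under `[CompactSpace V]`) and `IsSliceDiscIn`
  (constrains `X` only near `e(𝔻⁴) ∪ f(𝔻²)`): TRUE, no mutation finding, nothing for `Negative/`.
* §6 line `cruxideate-r1-k1-Sketch`: its transfer `C⁺ = LinkMPUnlink` ("`L` and a `0`-framed split
  unlink have a common surgery ⇒ components H-ball-slice") is IMPLIED BY the crux
  (`linkMPUnlink_of_crux`, proved here from `exists_isSurgery_zeroFramedUnlink_holds` + surgery
  uniqueness), and implies it given an `n`-component `0`-framed unlink (the Sketch's
  `crux_of_linkMPUnlink`): `C⁺` is NOT a proper strengthening — no separate attack surface.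

**Verdict of cycle 1 (cdisprove, 2026-08-17): NO KILL.**  The crux

  `∀ n (L : FramedLink (Fin n)) (Y : Type) [closed smooth 3-manifold],`
  `IsSphereTwoProdCircleSum n Y → L.IsSurgery (𝓡 3) Y → ∀ i, (L.component i).IsHomotopyBallSlice`

("every component of an R-link is slice in a homotopy 4-ball", Gompf–Scharlemann–Thompson 2010,
Prop. 2.3, componentwise) is a THEOREM on paper (close the trace `X_L` with `♮ⁿ S¹ × B³`; no
`1`-handles ⇒ `π₁ = 1`, `χ = 2`, `H₂ = 0` ⇒ `Σ_L ≃ S⁴`; `K_i` bounds the core of its `2`-handle in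
`Σ_L ∖ 0h`), and the typing is faithful: every predicate in the hypotheses is an HONEST gluing
predicate (`IsIntegralSurgeryLink`: open gluing of `S³ ∖ L` and solid tori along `surgeryRel νᵢ`
with `Y` Hausdorff; `IsSphereTwoProdCircleSum`: recursion over honest `IsConnectedSum`), so no junk
model of the hypotheses exists, and the conclusion `IsHomotopyBallSlice` is orientation-blind
(`∃ Σ` over all homotopy spheres, `∃ e` over ball charts of both orientations), so no convention
twist (mirror / reversal / framing sign) can falsify it.  What this file records, kernel-checked:

* §0 reading: the crux unfolds by `Iff.rfl`; its `n = 0` slice is trivially true (`Fin 0`); the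
  `n = 1` slice is the tree theorem built on `Knot.ManolescuPiccirillo2023_lemma33_sphere_holds`
  (see `STRATEGY-CENSUS.md` §Transfer) — not re-derived here.
* §1 LOAD-BEARING HYPOTHESES ("any proof must use H").  All three unconditional
  `_false_without_` statements need ONE input the tree does not have — a knot certified NOT slice
  in any homotopy ball (`ExistsKnotNotHomotopyBallSlice`; true: the trefoil, by Fox–Milnor /
  the signature, both valid in homology balls; no knot in the tree is certified non-slice even in
  `B⁴`).  Modulo that input they are PROVED here:
  - drop `L.IsSurgery (𝓡 3) Y`  ⇒ "every knot is H-ball-slice" (`withoutSurgery_iff`), false mod H;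
  - drop `IsSphereTwoProdCircleSum n Y` ⇒ the same conclusion via `0`-surgery on `K`
    (`exists_isIntegralSurgery_holds`), false mod H;
  - UNCOUPLE the component count from the number of `S² × S¹` summands ⇒ false mod H and the
    slam-dunk fact `SlamDunkSphere` (`(K, r) ∪ (meridian, 0)` is a surgery diagram of `S³`).
* §2 NATURAL STRENGTHENING "slice in `B⁴`" (`StrengtheningSliceInBall`): it follows from
  SPC4 + the crux (FGMW lemma, proved in the tree) and it is REFUTED by the route's other two
  cruxes (`VrlSlideGap`, `VrlSliceRigidity`) by pure logic — so it is exactly as hard as the route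
  and cannot be decided here; recorded as the tightness statement of the crux (the homotopy sphere
  in the conclusion cannot be upgraded to `S⁴` without deciding SPC4 on R-link spheres).
* §3 instance binders `[CompactSpace Y] [ConnectedSpace Y] [SecondCountableTopology Y]` are
  consequences of `L.IsSurgery (𝓡 3) Y` on paper (tree: `IsIntegralSurgery.compactSpace_holds`,
  `.connectedSpace_holds` for knots) — possibly unnecessary, harmless.
* §4 Targets: none served this cycle (no picked line in the payload).  Registered skeleton
  `Lines/kirby_lemma21.lean`: remarks at the end of this file.
* §5 near-misses: the unconditional `_false_without_` theorems, `sorry` = the missing input H.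
-/

-- `Summit.<Summit>.<Problem>`: single-conjunct summit, the duplicate component is mandated.
set_option linter.dupNamespace false

noncomputable section

namespace Summit.SmoothPoincare4.SmoothPoincare4.Cruxes.VrlComponentsHBallSlice.Disproof

open scoped Manifold ContDiff Topology LaurentPolynomial
open Set Function
open Literature.Topology.FourManifolds
open Summit.SmoothPoincare4.SmoothPoincare4.Theses.VerlindeRLinks

/-- Local notation: `𝕊 n` is the unit sphere in `EuclideanSpace ℝ (Fin (n + 1))`. -/
local notation "𝕊 " n:arg => (Metric.sphere (0 : EuclideanSpace ℝ (Fin (n + 1))) 1)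

/-! ## §0 Reading of the crux -/

/-- The crux, unfolded (definitional). [folklore] -/
theorem crux_iff :
    VrlComponentsHBallSlice ↔
      ∀ (n : ℕ) (L : FramedLink (Fin n)) (Y : Type) [TopologicalSpace Y] [T2Space Y]
        [SecondCountableTopology Y] [ChartedSpace (EuclideanSpace ℝ (Fin 3)) Y]
        [IsManifold (𝓡 3) ∞ Y] [CompactSpace Y] [ConnectedSpace Y],
        IsSphereTwoProdCircleSum n Y → L.IsSurgery (𝓡 3) Y →
          ∀ i : Fin n, (L.component i).IsHomotopyBallSlice :=
  Iff.rfl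

/-- Degenerate case `n = 0`: the conclusion quantifies over `Fin 0` and holds vacuously (the
hypotheses are even satisfiable there: `Y = S³`, `L` the empty link). [folklore] -/
theorem crux_zero (L : FramedLink (Fin 0)) (Y : Type) [TopologicalSpace Y] [T2Space Y]
    [SecondCountableTopology Y] [ChartedSpace (EuclideanSpace ℝ (Fin 3)) Y]
    [IsManifold (𝓡 3) ∞ Y] [CompactSpace Y] [ConnectedSpace Y]
    (_hY : IsSphereTwoProdCircleSum 0 Y) (_hL : L.IsSurgery (𝓡 3) Y) :
    ∀ i : Fin 0, (L.component i).IsHomotopyBallSlice :=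
  fun i => i.elim0

/-! ## §1 Load-bearing hypotheses

The missing input `H`.  Every unconditional `_false_without_` statement below needs a knot that
is certified NOT slice in any homotopy `4`-ball.  On paper: the trefoil (Fox–Milnor: `Δ_K ≐ f f̄`
for a knot slice in a HOMOLOGY `4`-ball; `Δ = t² - t + 1` is not of that form; equivalently
`σ = ±2 ≠ 0`).  In the tree no knot is certified non-slice even in `B⁴` (the Fox–Milnor and
Rasmussen facts of `SliceKnots.lean` / `Rasmussen.lean` are undischarged named facts, and none is
stated for homotopy balls), so `H` is carried as an explicit hypothesis. -/

/-- **H — some knot is not slice in any homotopy `4`-ball.**  True (the trefoil: Fox–Milnor's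
condition `Δ_K(t) ≐ f(t) f(t⁻¹)` and the signature obstruction hold for discs in any homology
`4`-ball bounded by `S³`), not certified in the tree for any knot.
[cite: FoxMilnor1966, Thm. 2] [cite: Murasugi1965, Thm. 8.2] -/
def ExistsKnotNotHomotopyBallSlice : Prop :=
  ∃ K : Knot, ¬ K.IsHomotopyBallSlice

/-- `H` is the failure of "every knot is H-ball-slice". [folklore] -/
theorem existsKnotNotHomotopyBallSlice_iff :
    ExistsKnotNotHomotopyBallSlice ↔ ¬ ∀ K : Knot, K.IsHomotopyBallSlice :=
  not_forall.symm

/-- Under SPC4, `H` is just the existence of a non-slice knot (contrapositive of the FGMW lemma,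
PROVED in the tree: `Knot.exists_exotic_of_isHomotopyBallSlice_not_isSmoothlySlice_holds`).
[cite: FreedmanGompfMorrisonWalker2010, §1] -/
theorem existsKnotNotHomotopyBallSlice_of_spc4 (hS : _root_.SmoothPoincare4)
    (h : ∃ K : Knot, ¬ K.IsSmoothlySlice) : ExistsKnotNotHomotopyBallSlice := by
  obtain ⟨K, hK⟩ := h
  refine ⟨K, fun hH => ?_⟩
  obtain ⟨M, _, _, _, _, _, _, ⟨e⟩, hE⟩ :=
    Knot.exists_exotic_of_isHomotopyBallSlice_not_isSmoothlySlice_holds ⟨K, hH, hK⟩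
  obtain ⟨d⟩ := hS M ‹_› ‹_› e
  exact hE.false d

/-- **The crux with the surgery hypothesis `L.IsSurgery (𝓡 3) Y` dropped.** [folklore] -/
def WithoutSurgery : Prop :=
  ∀ (n : ℕ) (L : FramedLink (Fin n)) (Y : Type) [TopologicalSpace Y] [T2Space Y]
    [SecondCountableTopology Y] [ChartedSpace (EuclideanSpace ℝ (Fin 3)) Y]
    [IsManifold (𝓡 3) ∞ Y] [CompactSpace Y] [ConnectedSpace Y],
    IsSphereTwoProdCircleSum n Y → ∀ i : Fin n, (L.component i).IsHomotopyBallSlice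

/-- Dropping the surgery hypothesis decouples `L` from `Y`: since a closed `Y ≅ S² × S¹` exists in
the tree (`exists_isSphereTwoProdCircleSum_closed 1`), the weakened statement says exactly that
EVERY knot is slice in a homotopy ball. [folklore] -/
theorem withoutSurgery_iff : WithoutSurgery ↔ ∀ K : Knot, K.IsHomotopyBallSlice := by
  constructor
  · intro hW K
    obtain ⟨Y, _, _, _, _, _, _, _, -, hY⟩ := exists_isSphereTwoProdCircleSum_closed 1
    simpa using hW 1 (FramedLink.single K 0) Y hY 0
  · intro h n L Y _ _ _ _ _ _ _ _ i
    exact h _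

/-- **`L.IsSurgery (𝓡 3) Y` is load-bearing** (modulo `H`): any proof of the crux must use the
surgery hypothesis. [folklore] -/
theorem vrlComponentsHBallSlice_false_without_surgery_of (h : ExistsKnotNotHomotopyBallSlice) :
    ¬ WithoutSurgery := fun hW =>
  (existsKnotNotHomotopyBallSlice_iff.1 h) (withoutSurgery_iff.1 hW)

/-- **The crux with the hypothesis `IsSphereTwoProdCircleSum n Y` dropped** (surgery on `L` is
some closed `3`-manifold, not necessarily `#ⁿ(S² × S¹)`). [folklore] -/
def WithoutSphereSum : Prop :=
  ∀ (n : ℕ) (L : FramedLink (Fin n)) (Y : Type) [TopologicalSpace Y] [T2Space Y]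
    [SecondCountableTopology Y] [ChartedSpace (EuclideanSpace ℝ (Fin 3)) Y]
    [IsManifold (𝓡 3) ∞ Y] [CompactSpace Y] [ConnectedSpace Y],
    L.IsSurgery (𝓡 3) Y → ∀ i : Fin n, (L.component i).IsHomotopyBallSlice

/-- The one-component framed link `(K, m)` indexed by `Unit` (the index type of `Link.ofKnot`).
[folklore] -/
def unitFramed (K : Knot) (m : ℤ) : FramedLink Unit :=
  ⟨Link.ofKnot K, fun _ => m⟩

/-- Dropping `IsSphereTwoProdCircleSum n Y` again forces every knot to be H-ball-slice: `0`-surgery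
on `K` exists as a closed smooth `3`-manifold (`exists_isIntegralSurgery_holds`, connected by
`IsIntegralSurgery.connectedSpace_holds`) and is a surgery on the one-component framed link
`(K, 0)` (`IsIntegralSurgery.isIntegralSurgeryLink_holds`, re-indexed `Unit ≃ Fin 1`).
[folklore] -/
theorem forall_isHomotopyBallSlice_of_withoutSphereSum (hW : WithoutSphereSum) :
    ∀ K : Knot, K.IsHomotopyBallSlice := by
  intro K
  obtain ⟨Y, _, _, _, _, _, _, hY⟩ := exists_isIntegralSurgery_holds K 0
  haveI : ConnectedSpace Y := IsIntegralSurgery.connectedSpace_holds hY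
  have hU : (unitFramed K 0).IsSurgery (𝓡 3) Y :=
    IsIntegralSurgery.isIntegralSurgeryLink_holds hY
  let e : Fin 1 ≃ Unit := finOneEquiv
  have hL : ((unitFramed K 0).reindex e).IsSurgery (𝓡 3) Y :=
    (FramedLink.isSurgery_reindex_iff_holds e (unitFramed K 0)).2 hU
  exact hW 1 ((unitFramed K 0).reindex e) Y hL 0

/-- Hence `WithoutSphereSum` is again EQUIVALENT to "every knot is H-ball-slice". [folklore] -/
theorem withoutSphereSum_iff : WithoutSphereSum ↔ ∀ K : Knot, K.IsHomotopyBallSlice :=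
  ⟨forall_isHomotopyBallSlice_of_withoutSphereSum, fun h _ _ _ _ _ _ _ _ _ _ _ _ => h _⟩

/-- What either dropped hypothesis would buy under SPC4: EVERY knot smoothly slice in `B⁴` (FGMW,
proved in the tree). [cite: FreedmanGompfMorrisonWalker2010, §1] -/
theorem forall_isSmoothlySlice_of_forall_isHomotopyBallSlice_of_spc4
    (h : ∀ K : Knot, K.IsHomotopyBallSlice) (hS : _root_.SmoothPoincare4) :
    ∀ K : Knot, K.IsSmoothlySlice := by
  intro K
  by_contra hK
  obtain ⟨M, _, _, _, _, _, _, ⟨e⟩, hE⟩ :=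
    Knot.exists_exotic_of_isHomotopyBallSlice_not_isSmoothlySlice_holds ⟨K, h K, hK⟩
  obtain ⟨d⟩ := hS M ‹_› ‹_› e
  exact hE.false d

/-- **`IsSphereTwoProdCircleSum n Y` is load-bearing** (modulo `H`): any proof of the crux must
use that the surgery is `#ⁿ(S² × S¹)`. [folklore] -/
theorem vrlComponentsHBallSlice_false_without_sphereSum_of (h : ExistsKnotNotHomotopyBallSlice) :
    ¬ WithoutSphereSum := fun hW =>
  (existsKnotNotHomotopyBallSlice_iff.1 h) (forall_isHomotopyBallSlice_of_withoutSphereSum hW)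

/-- **The crux with the component count UNCOUPLED from the number of summands**: an
`m`-component framed link whose surgery is `#ⁿ(S² × S¹)` for SOME `n`. [folklore] -/
def Uncoupled : Prop :=
  ∀ (m n : ℕ) (L : FramedLink (Fin m)) (Y : Type) [TopologicalSpace Y] [T2Space Y]
    [SecondCountableTopology Y] [ChartedSpace (EuclideanSpace ℝ (Fin 3)) Y]
    [IsManifold (𝓡 3) ∞ Y] [CompactSpace Y] [ConnectedSpace Y],
    IsSphereTwoProdCircleSum n Y → L.IsSurgery (𝓡 3) Y →
      ∀ i : Fin m, (L.component i).IsHomotopyBallSlice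

/-- The crux is the diagonal `m = n` of `Uncoupled`. [folklore] -/
theorem vrlComponentsHBallSlice_of_uncoupled (h : Uncoupled) : VrlComponentsHBallSlice :=
  fun n L Y _ _ _ _ _ _ _ hY hL => h n n L Y hY hL

/-- **Slam-dunk (statement).** For every knot `K` and framing `r` there is a `2`-component framed
link with first component `K` whose surgery is `S³` itself: `(K, r) ∪ (μ, 0)` with `μ` a meridian
of `K` (slide `K` over the `0`-framed meridian to unknot it, then cancel).  Stated, not proved
(needs a meridian as a `Knot` and the cancellation as an honest `IsIntegralSurgeryLink` on `𝕊 3`).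
[cite: GompfStipsicz1999, §5.1, Fig. 5.30 (slam-dunk)] -/
def SlamDunkSphere : Prop :=
  ∀ (K : Knot) (r : ℤ), ∃ L : FramedLink (Fin 2), L.component 0 = K ∧ L.IsSurgery (𝓡 3) (𝕊 3)

/-- **The coupling `#components = #summands` is load-bearing** (modulo `H` and the slam-dunk):
off the diagonal, at `(m, n) = (2, 0)`, every knot is a component of a framed link with surgery
`S³ = #⁰(S² × S¹)`. [folklore] -/
theorem uncoupled_false_of (hSD : SlamDunkSphere) (h : ExistsKnotNotHomotopyBallSlice) :
    ¬ Uncoupled := by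
  intro hU
  obtain ⟨K, hK⟩ := h
  obtain ⟨L, hLK, hL⟩ := hSD K 0
  haveI : ConnectedSpace (𝕊 3) := by
    refine isConnected_iff_connectedSpace.mp (isConnected_sphere ?_ 0 zero_le_one)
    rw [← Module.finrank_eq_rank, finrank_euclideanSpace_fin]
    norm_num
  have h0 : IsSphereTwoProdCircleSum 0 (𝕊 3) :=
    (isSphereTwoProdCircleSum_zero_iff _).2 ⟨Diffeomorph.refl (𝓡 3) _ ∞⟩
  have := hU 2 0 L (𝕊 3) h0 hL 0
  rw [hLK] at this
  exact hK this

/-! ## §1b (cycle 2) `H` discharged modulo named facts: the trefoil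

`H = ExistsKnotNotHomotopyBallSlice` follows from three printed theorems — two vendored named facts
of the tree and one explicit binder — plus kernel-checked algebra.  Witness: `torusKnot 2 3` (the
right-handed trefoil; `instTorusKnotFacts` is PROVED, so this is an honest `Knot`).  Inputs:
`isAlexanderPolynomial_torusKnot` (`Δ_{T(2,3)} = t² - t + 1`, closed form PROVED as
`torusKnotAlexander_two_three`), `exists_eq_mul_invert_of_isTopologicallySlice` (Fox–Milnor for flat
discs; PROVED in the tree from its geometric half `exists_ratMetabolic_hnnSeifertMatrix_of_isTopologicallySlice`),
and `hTop : ∀ K, K.IsHomotopyBallSlice → K.IsTopologicallySlice` (Freedman 1982 Thm. 1.6 + Brown's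
Schoenflies theorem: the punctured homotopy sphere is homeomorphic to `B⁴`; smooth disc + tubular
neighbourhood ↦ flat disc + product neighbourhood).  Landed as `Negative/LoadBearingTrefoil.lean`. -/

/-- `f(t⁻¹)|_{t=-1} = f(-1)`: evaluation at `-1` does not see `LaurentPolynomial.invert`. [folklore] -/
theorem eval₂_negOne_invert (f : ℤ[T;T⁻¹]) :
    LaurentPolynomial.eval₂ (RingHom.id ℤ) (-1) (LaurentPolynomial.invert f) =
      LaurentPolynomial.eval₂ (RingHom.id ℤ) (-1) f := by
  induction f using LaurentPolynomial.induction_on' with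
  | add p q hp hq => simp only [map_add, hp, hq]
  | C_mul_T n a =>
    simp only [map_mul, LaurentPolynomial.invert_C, LaurentPolynomial.invert_T,
      LaurentPolynomial.eval₂_C, LaurentPolynomial.eval₂_T, zpow_neg, Int.units_inv_eq_self]

/-- `Δ_{T(2,3)}(-1) = 3`. [cite: Rolfsen1976, §7.D Example 5] -/
theorem eval₂_negOne_torusKnotAlexander_two_three :
    LaurentPolynomial.eval₂ (RingHom.id ℤ) (-1) (torusKnotAlexander 2 3) = 3 := by
  rw [torusKnotAlexander_two_three]
  norm_num [LaurentPolynomial.eval₂_T, zpow_ofNat, Units.val_pow_eq_pow_val]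

/-- **Fox–Milnor obstruction for the trefoil (algebra, unconditional):** `t² - t + 1 ≠ u·f(t)·f(t⁻¹)`
in `ℤ[t, t⁻¹]` — at `t = -1` this would read `3 = ±m²`. [cite: FoxMilnor1966, §2 Thm. 2] -/
theorem torusKnotAlexander_two_three_ne_units_mul_mul_invert (f : ℤ[T;T⁻¹]) (u : ℤ[T;T⁻¹]ˣ) :
    torusKnotAlexander 2 3 ≠ ↑u * f * LaurentPolynomial.invert f := by
  intro h
  have hu : LaurentPolynomial.eval₂ (RingHom.id ℤ) (-1) (↑u : ℤ[T;T⁻¹]) *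
      LaurentPolynomial.eval₂ (RingHom.id ℤ) (-1) (↑u⁻¹ : ℤ[T;T⁻¹]) = 1 := by
    rw [← map_mul, Units.mul_inv, map_one]
  have h3 := congrArg (LaurentPolynomial.eval₂ (RingHom.id ℤ) (-1)) h
  rw [eval₂_negOne_torusKnotAlexander_two_three, map_mul, map_mul, eval₂_negOne_invert] at h3
  have hsq : 0 ≤ LaurentPolynomial.eval₂ (RingHom.id ℤ) (-1) f *
      LaurentPolynomial.eval₂ (RingHom.id ℤ) (-1) f := mul_self_nonneg _
  rcases Int.eq_one_or_neg_one_of_mul_eq_one hu with h1 | h1 <;> rw [h1] at h3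
  · have hlt : LaurentPolynomial.eval₂ (RingHom.id ℤ) (-1) f < 2 := by nlinarith
    have hgt : -2 < LaurentPolynomial.eval₂ (RingHom.id ℤ) (-1) f := by nlinarith
    generalize LaurentPolynomial.eval₂ (RingHom.id ℤ) (-1) f = m at *
    interval_cases m <;> omega
  · nlinarith

/-- The trefoil is not topologically slice, modulo `isAlexanderPolynomial_torusKnot` and the
topological Fox–Milnor fact. [cite: FoxMilnor1966, §2 Thm. 2] [cite: Rolfsen1976, §7.D Example 5] -/
theorem not_isTopologicallySlice_trefoil_of (hΔ : isAlexanderPolynomial_torusKnot)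
    (hFM : exists_eq_mul_invert_of_isTopologicallySlice) :
    ¬ (torusKnot 2 3 le_rfl (by norm_num) (by decide)).IsTopologicallySlice := by
  intro hK
  obtain ⟨f, u, h⟩ := hFM _ hK (hΔ le_rfl (by norm_num) (by decide))
  exact torusKnotAlexander_two_three_ne_units_mul_mul_invert f u h

/-- **`H` modulo named facts**: the trefoil is not slice in any homotopy ball, given the two named
facts and Freedman's `hTop`. [cite: Freedman1982, Thm. 1.6] [cite: FoxMilnor1966, §2 Thm. 2] -/
theorem existsKnotNotHomotopyBallSlice_of_foxMilnor (hΔ : isAlexanderPolynomial_torusKnot)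
    (hFM : exists_eq_mul_invert_of_isTopologicallySlice)
    (hTop : ∀ K : Knot, K.IsHomotopyBallSlice → K.IsTopologicallySlice) :
    ExistsKnotNotHomotopyBallSlice :=
  ⟨torusKnot 2 3 le_rfl (by norm_num) (by decide),
    fun h => not_isTopologicallySlice_trefoil_of hΔ hFM (hTop _ h)⟩

/-- Hence (cycle 2): **`L.IsSurgery (𝓡 3) Y` is load-bearing modulo three printed inputs only.**
[cite: FoxMilnor1966, §2 Thm. 2] [cite: Freedman1982, Thm. 1.6] -/
theorem vrlComponentsHBallSlice_false_without_surgery_of_foxMilnor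
    (hΔ : isAlexanderPolynomial_torusKnot) (hFM : exists_eq_mul_invert_of_isTopologicallySlice)
    (hTop : ∀ K : Knot, K.IsHomotopyBallSlice → K.IsTopologicallySlice) : ¬ WithoutSurgery :=
  vrlComponentsHBallSlice_false_without_surgery_of
    (existsKnotNotHomotopyBallSlice_of_foxMilnor hΔ hFM hTop)

/-- Hence (cycle 2): **`IsSphereTwoProdCircleSum n Y` is load-bearing modulo the same three inputs.**
[cite: FoxMilnor1966, §2 Thm. 2] [cite: Freedman1982, Thm. 1.6] -/
theorem vrlComponentsHBallSlice_false_without_sphereSum_of_foxMilnor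
    (hΔ : isAlexanderPolynomial_torusKnot) (hFM : exists_eq_mul_invert_of_isTopologicallySlice)
    (hTop : ∀ K : Knot, K.IsHomotopyBallSlice → K.IsTopologicallySlice) : ¬ WithoutSphereSum :=
  vrlComponentsHBallSlice_false_without_sphereSum_of
    (existsKnotNotHomotopyBallSlice_of_foxMilnor hΔ hFM hTop)

/-- Hence (cycle 2): **the coupling is load-bearing modulo the slam-dunk and the same three inputs.**
[cite: GompfStipsicz1999, §5.1 Fig. 5.30] [cite: FoxMilnor1966, §2 Thm. 2] -/
theorem uncoupled_false_of_foxMilnor (hSD : SlamDunkSphere)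
    (hΔ : isAlexanderPolynomial_torusKnot) (hFM : exists_eq_mul_invert_of_isTopologicallySlice)
    (hTop : ∀ K : Knot, K.IsHomotopyBallSlice → K.IsTopologicallySlice) : ¬ Uncoupled :=
  uncoupled_false_of hSD (existsKnotNotHomotopyBallSlice_of_foxMilnor hΔ hFM hTop)

/-! ## §2 The natural strengthening "slice in `B⁴`" is SPC4-complete relative to the route -/

/-- **Strengthening: every component of an R-link is smoothly slice in `B⁴`** (GST 2010, the
question after Prop. 2.3; true under SPC4, refuted by any non-standard R-link sphere). [folklore] -/
def StrengtheningSliceInBall : Prop :=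
  ∀ (n : ℕ) (L : FramedLink (Fin n)) (Y : Type) [TopologicalSpace Y] [T2Space Y]
    [SecondCountableTopology Y] [ChartedSpace (EuclideanSpace ℝ (Fin 3)) Y]
    [IsManifold (𝓡 3) ∞ Y] [CompactSpace Y] [ConnectedSpace Y],
    IsSphereTwoProdCircleSum n Y → L.IsSurgery (𝓡 3) Y →
      ∀ i : Fin n, (L.component i).IsSmoothlySlice

/-- SPC4 and the crux give the strengthening (FGMW lemma, proved in the tree).
[cite: FreedmanGompfMorrisonWalker2010, §1] -/
theorem strengtheningSliceInBall_of_spc4 (hS : _root_.SmoothPoincare4)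
    (hC : VrlComponentsHBallSlice) : StrengtheningSliceInBall := by
  intro n L Y _ _ _ _ _ _ _ hY hL i
  by_contra hi
  obtain ⟨M, _, _, _, _, _, _, ⟨e⟩, hE⟩ :=
    Knot.exists_exotic_of_isHomotopyBallSlice_not_isSmoothlySlice_holds
      ⟨L.component i, hC n L Y hY hL i, hi⟩
  obtain ⟨d⟩ := hS M ‹_› ‹_› e
  exact hE.false d

/-- **The strengthening is refuted by the route's other two cruxes** (pure logic, as in `closes`):
a slide gap plus slice rigidity produce an R-link component that is not slice in `B⁴`.  Hence the
homotopy sphere in the conclusion of the crux cannot be upgraded to `S⁴` inside this route — the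
crux is TIGHT there. [folklore] -/
theorem not_strengtheningSliceInBall_of_slideGap_of_sliceRigidity (h₁ : VrlSlideGap)
    (h₂ : VrlSliceRigidity) : ¬ StrengtheningSliceInBall := by
  intro hS
  obtain ⟨iν, n, L, Y, i₁, i₂, i₃, i₄, i₅, i₆, i₇, hY, hL, hgap⟩ := h₁
  obtain ⟨U, hU, hLU⟩ :=
    @h₂ iν n L Y i₁ i₂ i₃ i₄ i₅ i₆ i₇ hY hL (@hS n L Y i₁ i₂ i₃ i₄ i₅ i₆ i₇ hY hL)
  exact hgap U hU hLU

/-! ## §3 Possibly unnecessary hypotheses (information for the prover)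

The instance binders `[CompactSpace Y] [ConnectedSpace Y] [SecondCountableTopology Y]` (and even
`[T2Space Y]` for the pushout along `surgeryRel`, whose gluing region has proper closure relations)
follow on paper from `L.IsSurgery (𝓡 3) Y`; the tree proves the knot case
(`IsIntegralSurgery.compactSpace_holds`, `IsIntegralSurgery.connectedSpace_holds`,
`DehnSurgeryCompactProofs.lean`).  They are harmless in a `∀`-statement (more hypotheses), so no
mutation finding here; the framing values `L.framing` are forced to be `0` with vanishing linking
matrix by `H₁(Y) ≅ ℤⁿ` but the statement (correctly) does not assume it. -/

/-! ## §4 Targets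

None served (cycles 1–2: `stuck_stubs = []`, `targets = []`).  During cycle 1 the lead
(prover-line-stmt-SmoothPoincare4-15874-0, 11:55Z) registered skeleton `6a1aa010…` with FIVE stubs
(`stub_exists_disjoint_framedTubes`, `stub_attachingMap_of_tube`,
`stub_isSurgery_boundary_of_isMultiAttachment`, `stub_oneHandlebody_boundary`,
`stub_core_isSliceDiscIn_of_isMultiAttachment`), superseding `Lines/kirby_lemma21.lean`.  Paper
check of each signature against the tree definitions (`handleTube`, `tubeAngle/Fibre/Depth`,
`handleInversion` = Kosinski's `α`, `IsMultiAttachment`, `IsIntegralSurgeryLink`): NO STUB IS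
FALSIFIABLE; the two stubs with explicit formulas were checked by hand:

* `stub_attachingMap_of_tube` (`g y = (1 - tubeDepth y / 4) • ν (tubeAngle y, tubeFibre y)`): radius
  `(3 + ‖x‖²)/4 ∈ (3/4, 1]`, so `g` lands in `𝔻⁴`; injective (ν injective, the norm recovers the
  depth); immersive (`∂/∂depth` is radial, `dν` has rank 3 tangentially); range
  `{r • ν(θ,v) : r ∈ (3/4,1], ‖v‖² < 4r - 3}` is open in `𝔻⁴` because `ν(S¹ × ℝ²)` is open in `S³`
  (full-dimensional embedding); depth `0 ↦ ν(θ, v) ∈ ∂𝔻⁴`.  TRUE — a construction, no hypothesis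
  to mutate.
* `stub_isSurgery_boundary_of_isMultiAttachment`: only the depth-`0` values of `g i` enter `∂P`.
  For `y ∈ ∂D⁴ ∩ T ∖ S`, `s = |y_λ|² ∈ (0,1)`, `θ = y_λ/|y_λ|`, `v = y_μ` (`‖v‖² = 1 - s`):
  `h̄ᵢ y = νᵢ(θ, v)` (punctured unit tube) and Kosinski's `α y = (‖v‖ θ, √(1-‖v‖²) v̂)`, which under
  `(∂D⁴ ∖ S) ≅ D̊² × S¹`, `(x_λ, x_μ) ↦ (x_λ, x_μ/|x_μ|)` is `(‖v‖ θ, v̂)` — EXACTLY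
  `surgeryRel νᵢ` with `u = θ`, `t = ‖v‖`, `b.2 = v̂` (`a = ν(u, t • b.2)`, `b.1 = t • u`).  So the
  stub is the `n = 1` computation of `FramedLink.IsTrace.isIntegralSurgery_single` verbatim, one
  belt piece per component; the extra clauses of `IsIntegralSurgeryLink` (pairwise disjoint FULL
  tube ranges; pairwise disjoint solid tori) are respectively a HYPOTHESIS of the stub and the last
  clause of `IsMultiAttachment`.  `∀ bP` is as in the `n = 1` tree theorem.  TRUE.
* `stub_core_isSliceDiscIn_of_isMultiAttachment`: with THIS `g`, the radial ray `t • Kᵢ(φ)`,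
  `t ∈ (3/4, 1)`, equals `gᵢ (√(4t-3) θ, 0)` and is glued to `α = (√(4-4t) θ, 0)` in belt piece `i`,
  tending to its centre as `t → 1`: the slice disc is (annulus `c ≤ t ≤ 3/4 + ε` over `Kᵢ` in the
  `0`-handle) ∪ (the `λ`-axis disc `{(x_λ, 0) : |x_λ| < 1}` of belt piece `i`, linear hence smooth
  through the centre), with `e = j ∘ jA ∘ (ℝ⁴ ≅ B(0, c'))`, `c' ≤ 3/4` (the glue region of `gᵢ` sits
  at radii `> 3/4`, so `e(𝔻⁴)` misses every belt piece).  TRUE; `∃ e f` absorbs all conventions.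
* `stub_exists_disjoint_framedTubes`: thin pairwise disjoint tubes re-parametrised `ℝ² ≅ D̊²_ε`
  (framing class unchanged) and twisted to `L.framing i` (twisting keeps the range).  TRUE.
* `stub_oneHandlebody_boundary`: unchanged from `kirby_lemma21`; pure existence.  TRUE.
No `_false` target results; nothing for `Negative/`.

**Cycle-2 status (2026-08-17 ~12:45Z).**  LANDED by the lead: `stub_exists_disjoint_framedTubes`
(p159271, `…StubFramedTubes.lean`), `stub_attachingMap_of_tube` (p160952, `…StubAttachingMapOfTube.lean`,
25 lemmas), `stub_isSurgery_boundary_of_isMultiAttachment` (p160139, one-line instantiation of the new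
Literature theorem `FramedLink.isSurgery_boundary_of_isMultiAttachment`, Kirby's Lemma 2.1 for links).
ACTIVE: `stub_oneHandlebody_boundary`, `stub_core_isSliceDiscIn_of_isMultiAttachment`.  Re-read of
their vocabulary for typing traps:
* `HasHandleDecomposition 3 V (handleCount 1 n)` = a Morse function adapted to `∂V` with exactly
  `1 / n / 0…` critical points of index `0 / 1 / ≥ 2`, counted by `Set.ncard`; the junk value
  `ncard = 0` of an infinite critical set cannot occur under the stub's `[CompactSpace V]`
  (`IsMorse.finite_criticalSet`).  `IsOrientable (𝓡∂ 4) V` is REDUNDANT given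
  `IsSphereTwoProdCircleSum n ∂V` on paper (a non-orientable `1`-handlebody has non-orientable
  boundary, `#ⁿ(S² × S¹)` is orientable) but harmless in an `∃`-statement.  Model: `♮ⁿ(S¹ × B³)`
  (tree: `exists_oneHandlebody_four`, `OneHandlebodyBoundaryCarrier.lean`).  TRUE; `n = 0` is `D⁴`.
* `stub_core_isSliceDiscIn_of_isMultiAttachment`: the conclusion `∃ e f, K.IsSliceDiscIn X e f`
  constrains `X` only through a smooth embedding `e : ℝ⁴ → X` and a smooth `f : ℝ² → X`; everything
  is built inside `j(P°)` (shrunken `0`-handle of radius `c' < 3/4` for `e`, radial annulus + the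
  `λ`-axis core of handle `i` for `f`, extended radially inward for `‖x‖ > 1`), so the universal
  quantification over `X ⊇ j(P)` costs nothing.  Hypothesis mutation: dropping `IsMultiAttachment g P`
  or `IsSmoothEmbedding j` decouples `X` from `L` and the statement becomes "every knot is
  `IsSliceDiscIn` in every `4`-manifold", false at `X = ℝ⁴` for the trefoil only modulo a non-slice
  certificate (§1b inputs) — the same `H`-type input as for the crux, no new information; dropping the
  formula for `g` likewise.  TRUE as typed; no `Negative/` candidate. -/

/-! ## §5 Near-misses (the unconditional forms; `sorry` = the named facts of §1b) -/

/-- NEAR-MISS.  Unconditional form of `vrlComponentsHBallSlice_false_without_surgery_of_foxMilnor`.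
Obstruction (after cycle 2): exactly the three inputs of §1b — `isAlexanderPolynomial_torusKnot`
(the Alexander module of the trefoil group: a Wirtinger/Seifert–van Kampen computation over
`Knot.group`, not in the tree), the geometric half of Fox–Milnor
(`exists_ratMetabolic_hnnSeifertMatrix_of_isTopologicallySlice`: Seifert surfaces, "half lives half
dies" with topological transversality) and Freedman's "H-ball-slice ⇒ topologically slice"; each is a
theory-sized formalisation, none is refuter work.  Tried in cycle 1: tree search for
`¬ IsSmoothlySlice` / `¬ IsHomotopyBallSlice` / `trefoil` certificates (none); cycle 2: reduced the
`sorry` to these named facts with the algebra kernel-checked (§1b). [folklore] -/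
theorem vrlComponentsHBallSlice_false_without_surgery : ¬ WithoutSurgery := by
  sorry

/-- NEAR-MISS.  Unconditional form of `vrlComponentsHBallSlice_false_without_sphereSum_of_foxMilnor`;
same three named inputs (§1b). [folklore] -/
theorem vrlComponentsHBallSlice_false_without_sphereSum : ¬ WithoutSphereSum := by
  sorry

/-! ## §6 (cycle 2) Line `cruxideate-r1-k1-Sketch`: the transfer `C⁺ = LinkMPUnlink`

The picked line (PICKED.md, 11:42Z) drives the reshaped skeleton `Lines/kirby_lemma21.lean`
(stubs of §4) and keeps the k1 card's transfer `C⁺` as its statement-level reformulation: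
"a framed link `L` and a `0`-framed split unlink `U` with a COMMON surgery `Y` ⇒ every component of
`L` is H-ball-slice" (Sketch.lean `LinkMPUnlink`; `crux_of_linkMPUnlink` proved there modulo an
`n`-component `0`-framed unlink).  `FramedLink.IsZeroFramedUnlink` is honest (pairwise disjoint
smooth spanning discs + framings `0`), so `C⁺` cannot be attacked through a fake unlink (e.g. the
`0`-framed Hopf link, whose surgery is `S³`, is excluded).  Below: the crux IMPLIES `C⁺`
(`linkMPUnlink_of_crux`), by `exists_isSurgery_zeroFramedUnlink_holds` (surgery on `U` is a closed
`#ⁿ(S² × S¹)`), uniqueness of link surgery (`FramedLink.IsSurgery.nonempty_diffeomorph_holds`) and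
transport; so `C⁺ ⇔ crux` modulo the existence of `0`-framed unlinks, and `C⁺` offers no separate
attack surface (nor a shortcut: its `n = 1` anchor `ManolescuPiccirillo2023_lemma33_sphere_holds` is
the `n = 1` case of the crux already recorded by the strategist). -/

/-- `C⁺` of the k1 card, restated verbatim from `Ideas/dot-zero-unlink-partner.md` §Transfer (the
Sketch's `LinkMPUnlink`; primed here to avoid any clash). [cite: ManolescuPiccirillo2023, Lemma 3.3]
[cite: GompfScharlemannThompson2010, Prop. 2.3] -/
def LinkMPUnlink' : Prop :=
  ∀ (n : ℕ) (L U : FramedLink (Fin n)) (Y : Type) [TopologicalSpace Y] [T2Space Y]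
    [SecondCountableTopology Y] [ChartedSpace (EuclideanSpace ℝ (Fin 3)) Y] [IsManifold (𝓡 3) ∞ Y],
    U.IsZeroFramedUnlink → L.IsSurgery (𝓡 3) Y → U.IsSurgery (𝓡 3) Y →
      ∀ i : Fin n, (L.component i).IsHomotopyBallSlice

/-- **The crux implies `C⁺`** (so `C⁺` is not a proper strengthening): a common surgery with a
`0`-framed split unlink is a closed `#ⁿ(S² × S¹)` by `exists_isSurgery_zeroFramedUnlink_holds` and
uniqueness of link surgery, transported along the diffeomorphism. [folklore] -/
theorem linkMPUnlink_of_crux (hC : VrlComponentsHBallSlice) : LinkMPUnlink' := by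
  intro n L U Y _ _ _ _ _ hU hL hUY i
  obtain ⟨Y₀, _, _, _, _, _, _, _, hY₀, hUY₀⟩ := exists_isSurgery_zeroFramedUnlink_holds U hU
  obtain ⟨e⟩ := FramedLink.IsSurgery.nonempty_diffeomorph_holds hUY₀ hUY
  have hY : IsSphereTwoProdCircleSum n Y := hY₀.of_diffeomorph e
  haveI : CompactSpace Y := e.toHomeomorph.compactSpace
  haveI : ConnectedSpace Y := e.surjective.connectedSpace e.continuous
  exact hC n L Y hY hL i

end Summit.SmoothPoincare4.SmoothPoincare4.Cruxes.VrlComponentsHBallSlice.Disproof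

end
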